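import Literature.Probability.LatticeModels.MMPInequality
import Literature.Probability.LatticeModels.LatticePathChains
import Literature.Probability.LatticeModels.ThermodynamicLimit
import HarnessLib

/-!
# The XY model: torus two-point functions dominate free-box two-point functions (Ginibre)

Folklore consequence of Ginibre's inequality (J. Ginibre, Comm. Math. Phys. 16 (1970) 310–328,
monotonicity of `⟨cos(m·θ)⟩` in the ferromagnetic couplings; in the tree
`ginibreExpect_reChar_mono`) for the classical XY / plane-rotator model: if a finite region
`Λ ⊂ ℤ^d` is mapped injectively into the discrete torus `(ℤ/Lℤ)^d` by the canonical projection,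
then for every `J ≥ 0` and all `z, z' ∈ Λ`

  `⟨cos(θ_z − θ_{z'})⟩^{free}_{Λ,J} ≤ ⟨cos(θ_{π z} − θ_{π z'})⟩^{torus}_{L,J}`,

where the left side is the free-boundary Gibbs expectation of the bond system `latticeBonds Λ`
(`DisorderedXYModel`, `LatticePathChains`; weight `exp(J ∑_{edges ⊂ Λ} cos(θ_i − θ_j))`) and the
right side is the Ginibre expectation (`GinibreModel`) on the compact abelian group
`U(1)^{(ℤ/Lℤ)^d}` for the bond characters `θ ↦ θ̄_x θ_{x+eᵢ}` of the directed torus bonds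
`(x, i)` with constant couplings `J` (weight `exp(J ∑_{(x,i)} cos(θ_{x+eᵢ} − θ_x))`).
The proof is the one of `Literature.MathematicalPhysics.QuantumFieldTheory.GinibreU1TorusGeFreeBoxD4_holds`
for `U(1)` lattice gauge theory: the free-box expectation is the torus expectation with the
couplings of all bonds not coming from an edge of `Λ` switched off (both integrands depend only
on the spins at `π(Λ)`, whose joint law under the torus Haar measure is the Haar measure of
`U(1)^Λ`), and `0 ≤ J·[bond below an edge of Λ] ≤ J`.

Also recorded: Griffiths' first inequality `⟨Re χ₀⟩_J ≥ 0` for Ginibre models with non-negative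
couplings (the proof of `Literature.MathematicalPhysics.QuantumFieldTheory.ginibreExpect_reChar_nonneg`,
repeated here to keep the import closure inside `LatticeModels`), the description of the edges of
`ℤ^d` inside `Λ` by directed pairs `(z, i)` with `z, z + eᵢ ∈ Λ`, and the injectivity of the
projection on the centred cube `{-n,…,n}^d` for `2n < L`.

## References

* J. Ginibre, *General formulation of Griffiths' inequalities*, Comm. Math. Phys. 16 (1970)
  310–328, main theorem with the plane-rotator example. [Ginibre1970]
* S. Friedli, Y. Velenik, *Statistical Mechanics of Lattice Systems* (CUP 2017), §3.1 (boxes,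
  periodic boundary condition), §9.1 (XY model). [FriedliVelenik2017]
-/

noncomputable section

open MeasureTheory Finset
open scoped BigOperators ComplexConjugate

namespace Literature.Probability.LatticeModels

variable {d : ℕ}

/-! ### Directed pairs `(z, i)` and the edges of `ℤ^d` inside a region -/

/-- `eᵢ = eⱼ` in `ℤ^d` forces `i = j`. [folklore] -/
theorem single_one_injective {i j : Fin d}
    (h : (Pi.single i (1 : ℤ) : Site d) = Pi.single j 1) : i = j := by
  by_contra hij
  have h1 := congrFun h i
  rw [Pi.single_eq_same, Pi.single_eq_of_ne hij] at h1
  exact one_ne_zero h1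

/-- The edge map `(z, i) ↦ {z, z + eᵢ}` of `ℤ^d` is injective. [folklore] -/
theorem mkEdge_injective :
    Function.Injective fun p : Site d × Fin d => s(p.1, p.1 + Pi.single p.2 1) := by
  intro p q h
  have h' : s(p.1, p.1 + Pi.single p.2 (1 : ℤ)) = s(q.1, q.1 + Pi.single q.2 1) := h
  rcases Sym2.eq_iff.1 h' with ⟨hz, he⟩ | ⟨hz, he⟩
  · rw [hz, add_right_inj] at he
    exact Prod.ext hz (single_one_injective he)
  · rw [hz, add_assoc, add_eq_left] at he
    have h2 := congrFun he p.2
    simp only [Pi.add_apply, Pi.single_eq_same, Pi.zero_apply, Pi.single_apply] at h2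
    split_ifs at h2 <;> omega

/-- **The edges of `ℤ^d` inside `Λ` are the pairs `{z, z + eᵢ}` with `z, z + eᵢ ∈ Λ`**, each
exactly once. [folklore] -/
theorem edgesIn_eq_image_directed (Λ : Finset (Site d)) :
    edgesIn (zdGraph d) Λ =
      ((Λ ×ˢ Finset.univ).filter (fun p : Site d × Fin d => p.1 + Pi.single p.2 1 ∈ Λ)).image
        (fun p => s(p.1, p.1 + Pi.single p.2 1)) := by
  ext e
  simp only [Finset.mem_image, Finset.mem_filter, Finset.mem_product, Finset.mem_univ, and_true]
  constructor
  · intro he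
    induction e using Sym2.ind with
    | _ a b =>
      obtain ⟨hadj, hmem⟩ := mem_edgesIn_iff.1 he
      rw [SimpleGraph.mem_edgeSet, zdGraph_adj_iff] at hadj
      obtain ⟨i, hb | ha⟩ := hadj
      · refine ⟨(a, i), ⟨hmem a (Sym2.mem_mk_left a b), ?_⟩, ?_⟩
        · rw [← hb]; exact hmem b (Sym2.mem_mk_right a b)
        · simp only [hb]
      · refine ⟨(b, i), ⟨hmem b (Sym2.mem_mk_right a b), ?_⟩, ?_⟩
        · rw [← ha]; exact hmem a (Sym2.mem_mk_left a b)
        · simp only [← ha]; exact Sym2.eq_swap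
  · rintro ⟨p, ⟨hp1, hp2⟩, rfl⟩
    exact mk_mem_edgesIn Λ ((zdGraph_adj_iff _ _).2 ⟨p.2, Or.inl rfl⟩) hp1 hp2

/-- Sums over the edges of `ℤ^d` inside `Λ` as sums over directed pairs. [folklore] -/
theorem sum_edgesIn_eq_sum_directed {M : Type*} [AddCommMonoid M] (Λ : Finset (Site d))
    (g : Sym2 (Site d) → M) :
    ∑ e ∈ edgesIn (zdGraph d) Λ, g e =
      ∑ p ∈ (Λ ×ˢ Finset.univ).filter (fun p : Site d × Fin d => p.1 + Pi.single p.2 1 ∈ Λ),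
        g s(p.1, p.1 + Pi.single p.2 1) := by
  rw [edgesIn_eq_image_directed, Finset.sum_image fun p _ q _ h => mkEdge_injective h]

/-- **The energy of the free-boundary bond system of `Λ` on a configuration restricted from
`ℤ^d`**: `∑_{bonds} cos(θ_{tgt} − θ_{src}) = ∑_{(z,i) : z, z+eᵢ ∈ Λ} Re(θ̄_z θ_{z+eᵢ})`
(independent of the orientation chosen by `latticeBonds`). [folklore] -/
theorem latticeBonds_energy_one_comp (Λ : Finset (Site d)) (F : Site d → Circle) :
    (latticeBonds Λ).energy 1 (fun s : ↥Λ => F s) =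
      ∑ p ∈ (Λ ×ˢ Finset.univ).filter (fun p : Site d × Fin d => p.1 + Pi.single p.2 1 ∈ Λ),
        (conj ((F p.1 : Circle) : ℂ) * F (p.1 + Pi.single p.2 1)).re := by
  set g : Sym2 (Site d) → ℝ := Sym2.lift ⟨fun a b => (conj ((F a : Circle) : ℂ) * F b).re,
    fun a b => by
      show (conj ((F a : Circle) : ℂ) * F b).re = (conj ((F b : Circle) : ℂ) * F a).re
      rw [← Complex.conj_re (conj ((F a : Circle) : ℂ) * F b), map_mul, Complex.conj_conj,
        mul_comm]⟩ with hg
  have hsum : (latticeBonds Λ).energy 1 (fun s : ↥Λ => F s) =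
      ∑ a : ↥(edgesIn (zdGraph d) Λ), g (a : Sym2 (Site d)) := by
    rw [BondSystem.energy_one]
    refine Finset.sum_congr rfl fun a _ => ?_
    conv_rhs => rw [← Sym2.mk_out (a : Sym2 (Site d)), hg, Sym2.lift_mk]
    rfl
  rw [hsum, Finset.sum_coe_sort (edgesIn (zdGraph d) Λ) g, sum_edgesIn_eq_sum_directed]
  refine Finset.sum_congr rfl fun p _ => ?_
  rw [hg, Sym2.lift_mk]

/-! ### The projection to the torus -/

/-- Reduction mod `L` commutes with a unit step: `π(x + eᵢ) = π x + eᵢ` in `(ℤ/Lℤ)^d`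
(cf. `Literature.MathematicalPhysics.QuantumLattice.torusProj_add_single`). [folklore] -/
theorem torusProj_add_single_one (L : ℕ) (x : Site d) (i : Fin d) :
    Torus.proj L (x + Pi.single i 1) = Torus.proj L x + Pi.single i 1 := by
  funext j
  by_cases h : j = i
  · subst h; simp
  · simp [Pi.single_eq_of_ne h]

/-- `Torus.proj L` is injective on the centred cube `{-n,…,n}^d` as soon as `2n < L`
(cf. `torusProj_injOn_box` of `LroInfraredBound`, pointwise form). [folklore] -/
theorem torusProj_injOn_box_of_lt {n L : ℕ} (h : 2 * n < L) :
    Set.InjOn (Torus.proj (d := d) L) (box d n : Set (Site d)) := by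
  intro x hx y hy hxy
  funext k
  have hk : ((x k : ℤ) : ZMod L) = ((y k : ℤ) : ZMod L) := congrFun hxy k
  rw [ZMod.intCast_eq_intCast_iff_dvd_sub] at hk
  obtain ⟨hx1, hx2⟩ := mem_box.1 (Finset.mem_coe.1 hx) k
  obtain ⟨hy1, hy2⟩ := mem_box.1 (Finset.mem_coe.1 hy) k
  have hL : (2 * n : ℤ) < L := by exact_mod_cast h
  have hlt : |y k - x k| < (L : ℤ) := by
    rw [abs_lt]; constructor <;> linarith
  have h0 := Int.eq_zero_of_abs_lt_dvd hk hlt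
  linarith

/-! ### Marginals of product measures along injections -/

/-- **Marginal of a product measure along an injection.** For finite index types, a probability
measure `ν` and an injective `τ : S → E`, the image of `ν^{⊗E}` under `U ↦ U ∘ τ` is `ν^{⊗S}`
(adapted from `Literature.MathematicalPhysics.QuantumFieldTheory.map_comp_pi_of_injective`).
[folklore] -/
theorem pi_map_comp_injective {E S Y : Type*} [Fintype E] [Fintype S] [MeasurableSpace Y]
    (ν : Measure Y) [IsProbabilityMeasure ν] {τ : S → E} (hτ : Function.Injective τ) :
    (Measure.pi fun _ : E => ν).map (fun (U : E → Y) (s : S) => U (τ s)) =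
      Measure.pi fun _ : S => ν := by
  classical
  have hmeas : Measurable fun (U : E → Y) (s : S) => U (τ s) :=
    measurable_pi_lambda _ fun s => measurable_pi_apply _
  symm
  refine Measure.pi_eq fun A hA => ?_
  rw [Measure.map_apply hmeas (MeasurableSet.univ_pi hA)]
  let B : E → Set Y := fun e => if h : ∃ s, τ s = e then A h.choose else Set.univ
  have hpre : (fun (U : E → Y) (s : S) => U (τ s)) ⁻¹' Set.pi Set.univ A = Set.pi Set.univ B := by
    ext U
    simp only [Set.mem_preimage, Set.mem_univ_pi]
    constructor
    · intro hU e
      by_cases h : ∃ s, τ s = e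
      · have h1 := hU h.choose
        rw [h.choose_spec] at h1
        simp only [B, dif_pos h]
        exact h1
      · simp only [B, dif_neg h, Set.mem_univ]
    · intro hU s
      have h : ∃ s', τ s' = τ s := ⟨s, rfl⟩
      have h1 := hU (τ s)
      simp only [B, dif_pos h] at h1
      rwa [hτ h.choose_spec] at h1
  rw [hpre, Measure.pi_pi]
  have hprod : ∏ e, ν (B e) = ∏ e ∈ Finset.univ.image τ, ν (B e) := by
    symm
    refine Finset.prod_subset (Finset.subset_univ _) fun e _ he => ?_
    have h : ¬ ∃ s, τ s = e := fun ⟨s, hs⟩ =>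
      he (Finset.mem_image.2 ⟨s, Finset.mem_univ _, hs⟩)
    simp only [B, dif_neg h, measure_univ]
  rw [hprod, Finset.prod_image fun s _ s' _ hss' => hτ hss']
  refine Finset.prod_congr rfl fun s _ => ?_
  have h : ∃ s', τ s' = τ s := ⟨s, rfl⟩
  simp only [B, dif_pos h, hτ h.choose_spec]

/-! ### Griffiths' first inequality for Ginibre models -/

section GriffithsFirst

variable {Ω : Type*} [CommGroup Ω] [TopologicalSpace Ω] [IsTopologicalGroup Ω] [CompactSpace Ω]
  [MeasurableSpace Ω] [BorelSpace Ω]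

/-- The Haar integral of the real part of a continuous unitary character of a compact abelian
group is non-negative (it is `1` for the trivial character and `0` otherwise, by invariance
`∫ χ(ψθ) dθ = χ(ψ) ∫ χ(θ) dθ`) (same proof as
`Literature.MathematicalPhysics.QuantumFieldTheory.integral_reChar_nonneg`). [folklore] -/
theorem haarIntegral_reChar_nonneg (μ : Measure Ω) [μ.IsHaarMeasure] [IsFiniteMeasure μ]
    (χ₀ : Ω →ₜ* Circle) : 0 ≤ ∫ θ, reChar χ₀ θ ∂μ := by
  by_cases htriv : ∀ ψ : Ω, χ₀ ψ = 1
  · exact integral_nonneg fun θ => by simp [reChar, htriv θ]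
  push Not at htriv
  obtain ⟨ψ, hψ⟩ := htriv
  set f : Ω → ℂ := fun θ => ((χ₀ θ : Circle) : ℂ) with hf
  have hfc : Continuous f := continuous_subtype_val.comp χ₀.continuous
  have hfi : Integrable f μ := hfc.integrable_of_hasCompactSupport (HasCompactSupport.of_compactSpace f)
  have hinv : ∫ θ, f (ψ * θ) ∂μ = ∫ θ, f θ ∂μ := integral_mul_left_eq_self f ψ
  have hmul : ∫ θ, f (ψ * θ) ∂μ = ((χ₀ ψ : Circle) : ℂ) * ∫ θ, f θ ∂μ := by
    rw [← integral_const_mul]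
    refine integral_congr_ae (ae_of_all _ fun θ => ?_)
    simp [hf, map_mul]
  have hc0 : ∫ θ, f θ ∂μ = 0 := by
    have h1 : (((χ₀ ψ : Circle) : ℂ) - 1) * ∫ θ, f θ ∂μ = 0 := by
      rw [sub_mul, one_mul, ← hmul, hinv, sub_self]
    rcases mul_eq_zero.1 h1 with h | h
    · exact absurd (Circle.ext (by simpa [sub_eq_zero] using h)) hψ
    · exact h
  have hre : ∫ θ, reChar χ₀ θ ∂μ = (∫ θ, f θ ∂μ).re := by
    have h := integral_re hfi
    simpa [hf, reChar] using h
  rw [hre, hc0, Complex.zero_re]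

variable [SecondCountableTopology Ω] {ι : Type*} [Fintype ι]

/-- **Griffiths' first inequality for Ginibre models**: `⟨Re χ₀⟩_J ≥ 0` for non-negative
couplings (Ginibre monotonicity from `J = 0`, where the expectation is the Haar integral of
`Re χ₀ ≥ 0`) (same proof as
`Literature.MathematicalPhysics.QuantumFieldTheory.ginibreExpect_reChar_nonneg`).
[cite: Ginibre1970, main theorem with the plane-rotator example] -/
theorem torus_ginibreExpect_reChar_nonneg (μ : Measure Ω) [μ.IsHaarMeasure] [IsProbabilityMeasure μ]
    (h2 : Function.Surjective fun ψ : Ω => ψ * ψ) (χ : ι → Ω →ₜ* Circle) (χ₀ : Ω →ₜ* Circle)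
    {J : ι → ℝ} (hJ : ∀ a, 0 ≤ J a) : 0 ≤ ginibreExpect μ χ J (reChar χ₀) := by
  have h0 : ginibreExpect μ χ (fun _ => 0) (reChar χ₀) = ∫ θ, reChar χ₀ θ ∂μ := by
    have hw : ∀ θ, ginibreWeight χ (fun _ => (0 : ℝ)) θ = 1 := fun θ => by
      simp [ginibreWeight, ginibreHamiltonian]
    simp [ginibreExpect, hw]
  calc (0 : ℝ) ≤ ginibreExpect μ χ (fun _ => 0) (reChar χ₀) := by
        rw [h0]; exact haarIntegral_reChar_nonneg μ χ₀
    _ ≤ ginibreExpect μ χ J (reChar χ₀) :=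
        ginibreExpect_reChar_mono μ h2 χ χ₀ (fun _ => le_rfl) hJ

end GriffithsFirst

/-! ### The free box as a torus Ginibre model with switched-off couplings -/

section Torus

variable {L : ℕ}

/-- `Re` of a relative-angle character in coordinates: `Re χ_{x,y}(θ) = Re(θ̄_x θ_y)`. [folklore] -/
theorem reChar_diffChar_apply {V : Type*} (x y : V) (θ : V → Circle) :
    reChar (diffChar x y) θ = (conj ((θ x : Circle) : ℂ) * θ y).re := by
  rw [reChar, diffChar_apply, Circle.coe_mul, Circle.coe_inv_eq_conj]

/-- `Re χ_{x,y} = Re χ_{y,x}` (`cos` is even). [folklore] -/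
theorem reChar_diffChar_comm {V : Type*} (x y : V) (θ : V → Circle) :
    reChar (diffChar x y) θ = reChar (diffChar y x) θ := by
  rw [reChar_diffChar_apply, reChar_diffChar_apply, ← Complex.conj_re (conj ((θ x : Circle) : ℂ) * θ y),
    map_mul, Complex.conj_conj, mul_comm]

variable [NeZero L]

/-- **The torus Hamiltonian with the couplings of the bonds below `Λ` switched on**: if `π` is
injective on `Λ`, then `∑_{(x,i)} J·[(x,i) = (π z, i), z, z+eᵢ ∈ Λ] · Re(θ̄_x θ_{x+eᵢ})
= J ∑_{(z,i) : z, z+eᵢ ∈ Λ} Re(θ̄_{π z} θ_{π(z+eᵢ)})`. [folklore] -/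
theorem ginibreHamiltonian_boxCouplings (Λ : Finset (Site d))
    (hinj : Set.InjOn (Torus.proj (d := d) L) (Λ : Set (Site d))) (J : ℝ)
    (θ : TorusSite d L → Circle) :
    ginibreHamiltonian (fun b : TorusSite d L × Fin d => diffChar b.1 (b.1 + Pi.single b.2 1))
        (fun b => if b ∈ ((Λ ×ˢ Finset.univ).filter
            (fun p : Site d × Fin d => p.1 + Pi.single p.2 1 ∈ Λ)).image
            (fun p => (Torus.proj L p.1, p.2)) then J else 0) θ =
      J * ∑ p ∈ (Λ ×ˢ Finset.univ).filter (fun p : Site d × Fin d => p.1 + Pi.single p.2 1 ∈ Λ),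
        (conj ((θ (Torus.proj L p.1) : Circle) : ℂ) * θ (Torus.proj L (p.1 + Pi.single p.2 1))).re := by
  classical
  set D := (Λ ×ˢ Finset.univ).filter (fun p : Site d × Fin d => p.1 + Pi.single p.2 1 ∈ Λ) with hD
  have hinjD : Set.InjOn (fun p : Site d × Fin d => (Torus.proj L p.1, p.2)) (D : Set (Site d × Fin d)) := by
    intro p hp q hq h
    obtain ⟨h1, h2⟩ := Prod.mk.inj h
    have hp1 : p.1 ∈ Λ := (Finset.mem_product.1 (Finset.mem_filter.1 (Finset.mem_coe.1 hp)).1).1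
    have hq1 : q.1 ∈ Λ := (Finset.mem_product.1 (Finset.mem_filter.1 (Finset.mem_coe.1 hq)).1).1
    exact Prod.ext (hinj (Finset.mem_coe.2 hp1) (Finset.mem_coe.2 hq1) h1) h2
  unfold ginibreHamiltonian
  simp only [ite_mul, zero_mul, Finset.sum_ite_mem, Finset.univ_inter]
  rw [Finset.sum_image hinjD, Finset.mul_sum]
  refine Finset.sum_congr rfl fun p _ => ?_
  rw [reChar_diffChar_apply, torusProj_add_single_one]

/-- **The free-box XY two-point function is a torus Ginibre expectation with switched-off
couplings.** For `Λ ⊂ ℤ^d` on which the projection `π` to `(ℤ/Lℤ)^d` is injective, `z, z' ∈ Λ`: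
`⟨cos(θ_z − θ_{z'})⟩^{free}_{Λ,J}` equals the Gibbs expectation of `Re(θ̄_{π z} θ_{π z'})` on
`U(1)^{(ℤ/Lℤ)^d}` for the weight `exp(∑_{(x,i)} J_{(x,i)} Re(θ̄_x θ_{x+eᵢ}))` with
`J_{(x,i)} = J` if `(x, i) = (π w, i)` for some `w, w + eᵢ ∈ Λ` and `0` otherwise (both
integrands depend on the spins at `π(Λ)` only, whose law is the Haar measure of `U(1)^Λ`).
[folklore] -/
theorem latticeBonds_expect_cosDiff_eq_ginibreExpect [MeasurableSpace Circle] [BorelSpace Circle]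
    (Λ : Finset (Site d)) (hinj : Set.InjOn (Torus.proj (d := d) L) (Λ : Set (Site d))) (J : ℝ)
    {z z' : Site d} (hz : z ∈ Λ) (hz' : z' ∈ Λ) :
    (latticeBonds Λ).expect J 1 (cosDiff ⟨z, hz⟩ ⟨z', hz'⟩) =
      ginibreExpect (torusHaar (TorusSite d L))
        (fun b : TorusSite d L × Fin d => diffChar b.1 (b.1 + Pi.single b.2 1))
        (fun b => if b ∈ ((Λ ×ˢ Finset.univ).filter
            (fun p : Site d × Fin d => p.1 + Pi.single p.2 1 ∈ Λ)).image
            (fun p => (Torus.proj L p.1, p.2)) then J else 0)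
        (reChar (diffChar (Torus.proj L z) (Torus.proj L z'))) := by
  set G := latticeBonds Λ with hG
  set χ : TorusSite d L × Fin d → (TorusSite d L → Circle) →ₜ* Circle :=
    fun b => diffChar b.1 (b.1 + Pi.single b.2 1) with hχ
  set Jb : TorusSite d L × Fin d → ℝ := fun b => if b ∈ ((Λ ×ˢ Finset.univ).filter
      (fun p : Site d × Fin d => p.1 + Pi.single p.2 1 ∈ Λ)).image
      (fun p => (Torus.proj L p.1, p.2)) then J else 0 with hJb
  -- the restriction map and the marginal
  set τ : ↥Λ → TorusSite d L := fun s => Torus.proj L (s : Site d) with hτ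
  have hτinj : Function.Injective τ := fun s t h => Subtype.ext (hinj s.2 t.2 h)
  set ρ : (TorusSite d L → Circle) → (↥Λ → Circle) := fun u s => u (τ s) with hρ
  have hρm : Measurable ρ := measurable_pi_lambda _ fun s => measurable_pi_apply _
  have hmap : (torusHaar (TorusSite d L)).map ρ = torusHaar ↥Λ := by
    unfold torusHaar
    exact pi_map_comp_injective _ hτinj
  have transport : ∀ {g : (↥Λ → Circle) → ℝ}, Continuous g →
      ∫ φ, g φ ∂torusHaar ↥Λ = ∫ u, g (ρ u) ∂torusHaar (TorusSite d L) := by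
    intro g hg
    rw [← hmap, integral_map hρm.aemeasurable hg.aestronglyMeasurable]
  -- identification of the integrands
  have hw : ∀ u, G.weight J 1 (ρ u) = ginibreWeight χ Jb u := by
    intro u
    rw [BondSystem.weight, ginibreWeight, hχ, hJb, ginibreHamiltonian_boxCouplings Λ hinj J u, hG,
      show ρ u = fun s : ↥Λ => (u ∘ Torus.proj L) s from rfl, latticeBonds_energy_one_comp]
    rfl
  have hobs : ∀ u, cosDiff (⟨z, hz⟩ : ↥Λ) ⟨z', hz'⟩ (ρ u) =
      reChar (diffChar (Torus.proj L z) (Torus.proj L z')) u := by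
    intro u
    rw [reChar_diffChar_apply, cosDiff]
  unfold BondSystem.expect BondSystem.partitionFn ginibreExpect
  rw [transport (g := fun φ => cosDiff (⟨z, hz⟩ : ↥Λ) ⟨z', hz'⟩ φ * G.weight J 1 φ)
      ((continuous_cosDiff _ _).mul (G.continuous_weight J 1)),
    transport (G.continuous_weight J 1)]
  simp_rw [hw, hobs]

/-- **Torus two-point functions dominate free-box two-point functions (Ginibre).** For `J ≥ 0`,
a finite `Λ ⊂ ℤ^d` on which the projection `π : ℤ^d → (ℤ/Lℤ)^d` is injective and `z, z' ∈ Λ`: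
`⟨cos(θ_z − θ_{z'})⟩^{free}_{Λ,J} ≤ ⟨Re(θ̄_{π z} θ_{π z'})⟩^{torus}_{J}`, the torus expectation
being the Ginibre expectation on `U(1)^{(ℤ/Lℤ)^d}` with all directed-bond couplings equal to
`J` (weight `exp(J ∑_{(x,i)} cos(θ_{x+eᵢ} − θ_x))`): switch on the remaining couplings
(`ginibreExpect_reChar_mono`). [cite: Ginibre1970, main theorem with the plane-rotator example] -/
theorem latticeBonds_expect_cosDiff_le_torus [MeasurableSpace Circle] [BorelSpace Circle]
    (Λ : Finset (Site d)) (hinj : Set.InjOn (Torus.proj (d := d) L) (Λ : Set (Site d)))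
    {J : ℝ} (hJ : 0 ≤ J) {z z' : Site d} (hz : z ∈ Λ) (hz' : z' ∈ Λ) :
    (latticeBonds Λ).expect J 1 (cosDiff ⟨z, hz⟩ ⟨z', hz'⟩) ≤
      ginibreExpect (torusHaar (TorusSite d L))
        (fun b : TorusSite d L × Fin d => diffChar b.1 (b.1 + Pi.single b.2 1)) (fun _ => J)
        (reChar (diffChar (Torus.proj L z) (Torus.proj L z'))) := by
  rw [latticeBonds_expect_cosDiff_eq_ginibreExpect Λ hinj J hz hz']
  refine ginibreExpect_reChar_mono _ surjective_mul_self_torus _ _ (fun b => ?_) (fun b => ?_)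
  · split_ifs <;> [exact hJ; exact le_rfl]
  · split_ifs <;> [exact le_rfl; exact hJ]

end Torus

end Literature.Probability.LatticeModels

end
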